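import Summits.NavierStokesRegularity.NavierStokesRegularity.Theses.AxisymmetricExtremality
import Summits.NavierStokesRegularity.NavierStokesRegularity.Theorems.AxisymmetricExtremalityAxisymmetricKatoGlobalNoSwirlStratum
import Literature.Analysis.FluidPDE.AxisymmetricReflection
import Literature.Analysis.FluidPDE.Seregin2020AxisymmetricTypeII

/-!
# Strategist s17-g4 — kernel companion to `STRATEGY-CENSUS-s17-g4.md`
(crux `AxisymmetricKatoGlobal`, item stmt-NavierStokesRegularity-15453)

Sorry-free. Three certificates used by the census:

* §W0 `AxisymMinimalDatumAbsent` — the WEAKEST statement that can replace the crux in the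
  route's `closes` as typed today (no axisymmetric Rusin–Šverák minimal blow-up datum), with
  `absent_of_crux : AxisymmetricKatoGlobal → AxisymMinimalDatumAbsent` and
  `closes_of_absent : MinimalDatumPFold → PFoldToAxisymmetric → AxisymMinimalDatumAbsent →
  NavierStokesRegularity` (same pure-logic proof as the route's `closes`).
* §W1 the DIHEDRAL re-typing: `MinimalDatumDihedral` (Smith fixed points for the 2-groups
  `D_{2^k}` generated by `R_{2π/2^k}` and the meridian reflection `σ = reflY`) and
  `DihedralToO2` (compactness + axis pinning, the analogue of the PROVED `PFoldToAxisymmetric`);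
  `closes_dihedral : MinimalDatumDihedral → DihedralToO2 → NavierStokesRegularity` is proved
  OUTRIGHT from the landed no-swirl stratum
  `hasGlobalKatoSolution_of_isAxisymmetric_hasNoSwirl_viscosity` and
  `IsAxisymmetric.hasNoSwirl_iff_reflY` — i.e. after this re-typing the crux
  `AxisymmetricKatoGlobal` (= axisymmetric WITH swirl, ns.S25) is no longer load-bearing.
* §S the strengthening / split signatures quoted in the census (`Prop`s only, no claims).
-/

namespace Summit.NavierStokesRegularity.NavierStokesRegularity.Cruxes.AxisymmetricKatoGlobal.StrategistS17g4

open MeasureTheory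
open Literature.Analysis.FluidPDE Literature.Analysis.FunctionSpaces
open Summit.NavierStokesRegularity.NavierStokesRegularity.Theses.AxisymmetricExtremality
open Summit.NavierStokesRegularity.NavierStokesRegularity.Theorems.AxisymmetricKatoGlobal.NoSwirlStratum

local notation "ℝ³" => EuclideanSpace ℝ (Fin 3)
local notation "ℂ³" => EuclideanSpace ℂ (Fin 3)

/-! ## §W0 — the threshold instance: weakest replacement of the crux in `closes` -/

/-- W0: there is no axisymmetric `Ḣ^{1/2}`-minimal blow-up datum (for any viscosity). -/
def AxisymMinimalDatumAbsent : Prop :=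
  ∀ ν : ℝ, 0 < ν → ∀ (u₀ : ℝ³ → ℝ³) (g : HomSobolev ℝ³ ℂ³ (1 / 2 : ℝ)),
    IsMinimalBlowupDatum ν u₀ g → IsAxisymmetric u₀ → False

/-- The crux implies W0 (W0 is formally weaker: it only speaks about minimal data). -/
theorem absent_of_crux (h : AxisymmetricKatoGlobal) : AxisymMinimalDatumAbsent := by
  intro ν hν u₀ g hmin hax
  obtain ⟨hL3, hrep, hdiv, -, hnot⟩ := hmin
  exact hnot (h ν hν u₀ g hL3 hrep hdiv (fun θ x => hax θ x))

/-- W0 suffices for the route: the deciding theorem goes through verbatim with W0 in place of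
the crux (so `closes` consumes only the minimal-datum instance of `AxisymmetricKatoGlobal`). -/
theorem closes_of_absent (h₂ : MinimalDatumPFold) (h₄ : PFoldToAxisymmetric)
    (h₃ : AxisymMinimalDatumAbsent) : NavierStokesRegularity := by
  show Literature.NS.NavierStokesExistenceSmoothR3
  intro ν hν u₀ hsm hdiv hdec
  by_contra hno
  obtain ⟨u₁, g, hmin, hax⟩ := h₄ ν hν (h₂ ν hν ⟨u₀, hsm, hdiv, hdec, hno⟩)
  exact h₃ ν hν u₁ g hmin (fun θ x => hax θ x)

/-! ## §W1 — the dihedral re-typing: the crux drops out of the route -/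

/-- The Clay-failure antecedent of `MinimalDatumPFold` (verbatim). -/
def ClayFails (ν : ℝ) : Prop :=
  ∃ v₀ : ℝ³ → ℝ³, ContDiff ℝ (⊤ : ℕ∞) v₀ ∧ NSWave0.IsDivFree v₀ ∧ HasRapidSpatialDecay v₀ ∧
    ¬ ∃ (u : ℝ → ℝ³ → ℝ³) (p : ℝ → ℝ³ → ℝ), IsSmoothOnHalfSpace u ∧ IsSmoothOnHalfSpace p ∧
      IsNavierStokesSolution ν 0 v₀ u p ∧ HasBoundedEnergy u

/-- A datum is `D_{2^k}`-equivariant: fixed by conjugation with the rotation `R_{2π/2^k}` about the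
axis and with the meridian reflection `σ (x₀,x₁,x₂) = (x₀,−x₁,x₂)` (`reflY`). The group generated
is the dihedral group of order `2^{k+1}`, a finite 2-group. -/
def IsDihedralSymmetric (k : ℕ) (u₀ : ℝ³ → ℝ³) : Prop :=
  (∀ x, u₀ (rotZ (2 * Real.pi / 2 ^ k) x) = rotZ (2 * Real.pi / 2 ^ k) (u₀ x)) ∧
  (∀ x, u₀ (reflY x) = reflY (u₀ x))

/-- For all large `k` there is a `D_{2^k}`-equivariant minimal blow-up datum. -/
def DihedralMinimalData (ν : ℝ) : Prop :=
  ∀ N : ℕ, ∃ k : ℕ, N ≤ k ∧ ∃ (u₀ : ℝ³ → ℝ³) (g : HomSobolev ℝ³ ℂ³ (1 / 2 : ℝ)),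
    IsMinimalBlowupDatum ν u₀ g ∧ IsDihedralSymmetric k u₀

/-- W1-crux A (replaces `MinimalDatumPFold`): Clay failure ⇒ `D_{2^k}`-equivariant minimal blow-up
data for all large `k`. Mechanism: P. A. Smith's fixed-point theorem for the finite 2-GROUPS
`D_{2^k}` acting on the compact moduli space `M̂ = M/Sim` — it needs `M̂` to be `𝔽₂`-acyclic
(Čech), which is WEAKER than the `𝔽_p`-acyclicity for infinitely many primes `p` behind
`MinimalDatumPFold`; plus the same `liftModSim` step. -/
def MinimalDatumDihedral : Prop :=
  ∀ ν : ℝ, 0 < ν → ClayFails ν → DihedralMinimalData ν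

/-- W1-crux B (replaces `PFoldToAxisymmetric`, same compactness + axis-pinning argument, the
reflection passes to the limit): dihedral minimal data for all large `k` ⇒ an `O(2)`-equivariant
minimal datum, i.e. axisymmetric AND mirror-symmetric in a meridian plane. -/
def DihedralToO2 : Prop :=
  ∀ ν : ℝ, 0 < ν → DihedralMinimalData ν →
    ∃ (u₀ : ℝ³ → ℝ³) (g : HomSobolev ℝ³ ℂ³ (1 / 2 : ℝ)),
      IsMinimalBlowupDatum ν u₀ g ∧ IsAxisymmetric u₀ ∧ ∀ x, u₀ (reflY x) = reflY (u₀ x)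

/-- **The dihedral deciding theorem, proved outright.** An `O(2)`-equivariant field is
axisymmetric WITHOUT swirl (`IsAxisymmetric.hasNoSwirl_iff_reflY`), and the swirl-free stratum of
the crux is a THEOREM of the tree (`hasGlobalKatoSolution_of_isAxisymmetric_hasNoSwirl_viscosity`,
Ladyzhenskaya / Ukhovskii–Yudovich 1968 in the Kato class). Hence with the dihedral re-typing the
route closes WITHOUT `AxisymmetricKatoGlobal`. -/
theorem closes_dihedral (hA : MinimalDatumDihedral) (hB : DihedralToO2) :
    NavierStokesRegularity := by
  show Literature.NS.NavierStokesExistenceSmoothR3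
  intro ν hν u₀ hsm hdiv hdec
  by_contra hno
  obtain ⟨u₁, g, hmin, hax, hrefl⟩ := hB ν hν (hA ν hν ⟨u₀, hsm, hdiv, hdec, hno⟩)
  obtain ⟨hL3, -, hdiv₁, -, hnot⟩ := hmin
  have hsw : HasNoSwirl u₁ := (IsAxisymmetric.hasNoSwirl_iff_reflY hax).2 hrefl
  exact hnot (hasGlobalKatoSolution_of_isAxisymmetric_hasNoSwirl_viscosity hν hL3 hdiv₁ hax hsw)

/-- Sanity: the dihedral pieces are implied by the present route's items together with the crux
restricted to… — NOT claimed; recorded instead: the present `PFoldToAxisymmetric` is the `σ`-free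
shadow of `DihedralToO2` (drop the reflection clause). -/
theorem pFold_shadow (hB : DihedralToO2) (ν : ℝ) (hν : 0 < ν) (h : DihedralMinimalData ν) :
    ∃ (u₀ : ℝ³ → ℝ³) (g : HomSobolev ℝ³ ℂ³ (1 / 2 : ℝ)),
      IsMinimalBlowupDatum ν u₀ g ∧ IsAxisymmetric u₀ := by
  obtain ⟨u₀, g, hmin, hax, -⟩ := hB ν hν h
  exact ⟨u₀, g, hmin, hax⟩

/-! ## §S — signatures quoted in the census (statements only; nothing is claimed about them) -/

/-- S⁺ (## Strengthen): the QUANTITATIVE axisymmetric Kato theorem — a uniform scattering-size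
bound. By the Gallagher–Koch–Planchon / Rusin–Šverák dichotomy restricted to the (closed,
scaling- and axial-translation-invariant) axisymmetric class, qualitative globality for ALL
axisymmetric `Ḣ^{1/2}` data already yields such an `F`; so S⁺ is not a more rigid target, it is the
same target (census §Strengthen). Typed over the tree's `HasGlobalKatoSolution` only through its
consequence: every axisymmetric datum of norm `< ρ` is global, for every `ρ`. -/
def AxisymGlobalBelow (ν : ℝ) (ρ : ENNReal) : Prop :=
  ∀ (u₀ : ℝ³ → ℝ³) (g : HomSobolev ℝ³ ℂ³ (1 / 2 : ℝ)),
    MemLp u₀ 3 volume → g.Represents (EuclideanSpace.complexify ∘ u₀) → IsWeaklyDivFree u₀ →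
    IsAxisymmetric u₀ → ‖g‖ₑ < ρ → HasGlobalKatoSolution ν u₀

/-- The crux is `∀ ρ, AxisymGlobalBelow ν ρ` (induction-on-norm form). -/
theorem crux_iff_globalBelow_all :
    AxisymmetricKatoGlobal ↔ ∀ ν : ℝ, 0 < ν → ∀ ρ : ENNReal, AxisymGlobalBelow ν ρ := by
  constructor
  · intro h ν hν ρ u₀ g hL3 hrep hdiv hax _
    exact h ν hν u₀ g hL3 hrep hdiv (fun θ x => hax θ x)
  · intro h ν hν u₀ g hL3 hrep hdiv hax
    exact h ν hν (‖g‖ₑ + 1) u₀ g hL3 hrep hdiv (fun θ x => hax θ x)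
      (ENNReal.lt_add_right enorm_ne_top one_ne_zero)

/-! ## §D — the typed two-piece split examined in the census (`## Decomposition`), LOCAL form

Both pieces are stated over the tree's accepted local class of Seregin 2020, Thm 2.1
(`Seregin2020_axisymmetricSingularPoint_typeII`): axisymmetric suitable weak solutions in the unit
parabolic cylinder. Nothing is claimed about them here; the census explains why neither has an
engine (P1 = the excluded endpoint `d = 1` of Chen–Fang–Zhang 2017 Thm 1.1, where the cylindrical
Hardy inequality fails in codimension 2; P2 = swirl evacuation, known only in the Type-I regime). -/

open Set in
/-- The local axisymmetric suitable class of Seregin 2020 Thm 2.1 on `Q = 𝒞(0,1) × ]−1,0[`,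
packaged as one predicate (verbatim hypotheses of `Seregin2020_axisymmetricSingularPoint_typeII`). -/
def IsLocalAxisymSuitable (u : ℝ → ℝ³ → ℝ³) (p : ℝ → ℝ³ → ℝ)
    (G : ℝ → ℝ³ → ℝ³ →L[ℝ] ℝ³) : Prop :=
  IsSuitableWeakSolutionOn (SereginSverak2009.parCylOpens 0 1) 1 0 u p ∧
  (∃ C : NNReal, ∀ᵐ t ∂(volume.restrict (Ioo (-1 : ℝ) 0)),
      ∫⁻ x in SereginSverak2009.spaceCyl 0 1, ‖u t x‖ₑ ^ 2 ≤ C) ∧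
  HasWeakSpatialGradientOn (SereginSverak2009.parCylOpens 0 1) u G ∧
  (∫⁻ z in SereginSverak2009.parCyl 0 1, ENNReal.ofReal (frobeniusNormSq (G z.1 z.2)) < ⊤) ∧
  (∫⁻ z in SereginSverak2009.parCyl 0 1, ‖p z.1 z.2‖ₑ ^ (3 / 2 : ℝ) < ⊤) ∧
  (∀ t ∈ Ioo (-1 : ℝ) 0, IsAxisymmetric (u t)) ∧
  (∀ t ∈ Ioo (-1 : ℝ) 0, IsAxisymmetricScalar (p t))

open Set in
/-- P1 — ENDPOINT small-swirl ε-regularity (the `d = 1`, `q = ∞` case excluded from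
Chen–Fang–Zhang 2017 Thm 1.1(ii); OPEN): a uniformly small swirl `|Γ| = |r u_θ| ≤ ε` on the unit
cylinder rules out a singularity at the origin. -/
def SmallSwirlEpsRegularity : Prop :=
  ∃ ε : ℝ, 0 < ε ∧ ∀ (u : ℝ → ℝ³ → ℝ³) (p : ℝ → ℝ³ → ℝ) (G : ℝ → ℝ³ → ℝ³ →L[ℝ] ℝ³),
    IsLocalAxisymSuitable u p G →
    (∀ t ∈ Ioo (-1 : ℝ) 0, ∀ x ∈ SereginSverak2009.spaceCyl 0 1, |swirl (u t) x| ≤ ε) →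
    ¬ IsBackwardSingularPoint u 0

open Set in
/-- P2 — swirl EVACUATION at an axis singular point (OPEN outside Type I): at a backward singular
point at the origin the swirl tends to `0`, i.e. `Γ` is small on small parabolic cylinders. -/
def SwirlEvacuation : Prop :=
  ∀ (u : ℝ → ℝ³ → ℝ³) (p : ℝ → ℝ³ → ℝ) (G : ℝ → ℝ³ → ℝ³ →L[ℝ] ℝ³),
    IsLocalAxisymSuitable u p G → IsBackwardSingularPoint u 0 →
    ∀ ε : ℝ, 0 < ε → ∃ ρ : ℝ, 0 < ρ ∧ ρ ≤ 1 ∧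
      ∀ t ∈ Ioo (-(ρ ^ 2)) 0, ∀ x ∈ SereginSverak2009.spaceCyl 0 ρ, |swirl (u t) x| ≤ ε

/-- The joint local target both pieces feed (via parabolic rescaling of the `ρ`-cylinder to the unit
one): no axis singular point for axisymmetric suitable weak solutions — which, composed with the
LANDED localisation stubs of `Lines/euler_scaling.lean` (Kato blow-up ⇒ axis singular point at
`T_max`), is the crux. Recorded as a `Prop`; the seam is not proved in this sketch. -/
def NoAxisSingularPoint : Prop :=
  ∀ (u : ℝ → ℝ³ → ℝ³) (p : ℝ → ℝ³ → ℝ) (G : ℝ → ℝ³ → ℝ³ →L[ℝ] ℝ³),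
    IsLocalAxisymSuitable u p G → ¬ IsBackwardSingularPoint u 0

end Summit.NavierStokesRegularity.NavierStokesRegularity.Cruxes.AxisymmetricKatoGlobal.StrategistS17g4
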